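import Summits.BirchSwinnertonDyer.BirchSwinnertonDyer.Theses.CMKolyvaginAtInertTwo

/-!
# Route `CMKolyvaginAtInertTwo`, LINE 15: the glue of the Ш[2]-regime split holds (by name)

Item `CMKolyvaginConjectureOfShaRegimes` (support/glue of the LINE-15 split of crux
`CMKolyvaginConjectureAtInertTwo`, stmt-BirchSwinnertonDyer-24648, into the trivial-Ш regime R0
`CMHeegnerTwoPrimitiveOfTrivialShaTwo` (Ш(E/K)[2^∞] = 0 ⇒ `y_K` not `2`-divisible in `E(K[1])`) and the
non-trivial-Ш regime R1 `CMKolyvaginDescentOfNontrivialShaTwo` (Ш(E/K)[2^∞] ≠ 0 ⇒ some derived point `P(n)`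
is `2`-primitive)). Pen seat `bsd-idea-1` g7. THEOREM-ONLY file (no definition, no named fact, no `sorry`):
introduce the frame and split on `Ш(E/K)[2^∞] = ⊥`; in the first case the witness is `n = 1`, `d = d₁`.
BSD is not proved by this; 24648 is not proved by this (children ⟹ parent only); R0 and R1 stay open.
-/

set_option autoImplicit false
set_option linter.dupNamespace false
set_option linter.unusedVariables false

namespace Summit.BirchSwinnertonDyer.BirchSwinnertonDyer.Theorems.CMSupply

open scoped Classical
open Summit.BirchSwinnertonDyer.BirchSwinnertonDyer.Theses.CMKolyvaginAtInertTwo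

/-- **Glue of LINE 15** (by name): `CMHeegnerTwoPrimitiveOfTrivialShaTwo → CMKolyvaginDescentOfNontrivialShaTwo →
CMKolyvaginConjectureAtInertTwo` — excluded middle on `Ш(E/K)[2^∞] = ⊥`. [folklore] -/
theorem cmKolyvaginConjectureOfShaRegimes_proof : CMKolyvaginConjectureOfShaRegimes := by
  intro h₀ h₁ W _ _ _ hcm hin hρ hr hT K _ _ hK hodd hne3 hHN Dt hopt hc β ι d₁ hy
  by_cases hSha : AddCommGroup.primaryComponent (W.baseChange K).sha 2 = ⊥
  · exact ⟨1, d₁, squarefree_one, by simp, h₀ W hcm hin hρ hr hT K hK hodd hne3 hHN Dt hopt hc β ι d₁ hy hSha⟩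
  · exact h₁ W hcm hin hρ hr hT K hK hodd hne3 hHN Dt hopt hc β ι d₁ hy hSha

end Summit.BirchSwinnertonDyer.BirchSwinnertonDyer.Theorems.CMSupply
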